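import Literature.NumberTheory.GaloisRepresentations.LiftingObstructionParabolic
import Literature.NumberTheory.GaloisRepresentations.NearlyOrdinaryDeformationRing
import HarnessLib

/-!
# The local (Borel) lifting obstruction of `ρ_𝒟 mod 𝔪ⁿ` at the places above `p`

Topic `Literature/NumberTheory/GaloisRepresentations`.  For `𝓡` a (universal) nearly ordinary
deformation ring of a residual datum `𝒟` (`NearlyOrdinaryDeformationRing.lean`), `v ∣ p` and
`n ≥ 0`:

* `localModPow v n` — `ρ_𝒟|_{Γ_{F_v}}` in the nearly-ordinary frame `noFrame v`, reduced mod `𝔪ⁿ`: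
  a homomorphism `Γ_{F_v} → GL₂(R_𝒟/𝔪ⁿ)` with open kernel (`isOpen_ker_localModPow`) and values
  in the Borel subgroup of upper-triangular matrices (`localModPow_mem_borel`,
  `LiftingObstruction.parabolicGL id`);
* for a surjection `q : B ↠ R_𝒟/𝔪ⁿ` with square-zero kernel `I` (`B` discrete):
  `localObstruction` — Mazur's Borel obstruction class
  `o_v(ρ_n) ∈ H²_cont(Γ_{F_v}, 𝔟 ⊗ I)` (`LiftingObstruction.parabolicObstructionClass` for the
  standard Borel-compatible section `stdSection`), with
  **`exists_borelLift_of_localObstruction_eq_zero`**: if `o_v(ρ_n) = 0` then `ρ_n|_{Γ_{F_v}}`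
  lifts to an UPPER-TRIANGULAR homomorphism `Γ_{F_v} → GL₂(B)` with open kernel, and the converse
  `localObstruction_eq_zero_of_borelLift`.

This is the local term at `v ∣ p` (Böckle 2007, Ex. 6.1 (a) and Prop. 7.5: the nearly ordinary
local condition is the functor of upper-triangular lifts in a fixed frame, with tangent/obstruction
spaces `H¹`/`H²(G_v, 𝔟_v)`) of the obstruction map feeding
`NearlyOrdinaryPresentationProofs.nearlyOrdinaryPresentation_of_obstruction`; the global term is
`DeformationLiftingObstruction.globalObstruction`.  Everything is proved; no named facts.

## References

* B. Mazur, *Deforming Galois representations*, in Galois groups over `ℚ`, MSRI Publ. 16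
  (1989), §1.6 Prop. 2, §1.7. [cite: Mazur1989Deforming, §1.6 Prop. 2]
* G. Böckle, *Presentations of universal deformation rings*, LMS LNS 320 (2007), Ex. 6.1 (a),
  Prop. 7.5, Thm. 7.6. [cite: Bockle2007Presentations, Theorem 7.6]
-/

noncomputable section

open scoped NumberField
open Field IsDedekindDomain IsLocalRing Topology

namespace Literature.NumberTheory.GaloisRepresentations

namespace NearlyOrdinaryDeformationRing

variable {F : Type} [Field F] [NumberField F] {p : ℕ} {𝒪 : Type} [CommRing 𝒪] {k : Type}
  [Field k] [Algebra 𝒪 k] {𝒟 : NearlyOrdinaryDatum F p 𝒪 k}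
  (𝓡 : NearlyOrdinaryDeformationRing.{0} 𝒟)

/-- `F_v` has characteristic `0` (it contains `F`). [folklore] -/
theorem charZero_adicCompletion' (v : HeightOneSpectrum (𝓞 F)) : CharZero (v.adicCompletion F) :=
  charZero_of_injective_algebraMap (algebraMap F (v.adicCompletion F)).injective

attribute [local instance] charZero_adicCompletion'

/-! ## 1. `ρ_𝒟|_{Γ_{F_v}}` in the nearly-ordinary frame, mod `𝔪ⁿ` -/

/-- The nearly-ordinary frame reduced mod `𝔪ⁿ`. [folklore] -/
def noFrameModPow (v : HeightOneSpectrum (𝓞 F)) (n : ℕ) :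
    GL (Fin 2) (𝓡.R ⧸ maximalIdeal 𝓡.R ^ n) :=
  Matrix.GeneralLinearGroup.map (Ideal.Quotient.mk (maximalIdeal 𝓡.R ^ n)) (𝓡.noFrame v)

/-- **`ρ_𝒟|_{Γ_{F_v}}` in the frame `noFrame v`, reduced mod `𝔪ⁿ`**:
`σ ↦ (noFrame v)⁻¹ ρ_𝒟(σ) (noFrame v) mod 𝔪ⁿ`. [cite: Bockle2007Presentations, Theorem 7.6] -/
def localModPow (v : HeightOneSpectrum (𝓞 F)) (n : ℕ) :
    absoluteGaloisGroup (v.adicCompletion F) →* GL (Fin 2) (𝓡.R ⧸ maximalIdeal 𝓡.R ^ n) :=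
  (Matrix.GeneralLinearGroup.map (Ideal.Quotient.mk (maximalIdeal 𝓡.R ^ n))).comp (𝓡.localRep v)

/-- Unfolding `localModPow`. [folklore] -/
theorem localModPow_apply (v : HeightOneSpectrum (𝓞 F)) (n : ℕ)
    (σ : absoluteGaloisGroup (v.adicCompletion F)) :
    𝓡.localModPow v n σ =
      Matrix.GeneralLinearGroup.map (Ideal.Quotient.mk (maximalIdeal 𝓡.R ^ n))
        (𝓡.localRep v σ) :=
  rfl

/-- `localModPow` is the conjugate of `modPow ∘ (Γ_{F_v} → Γ_F)` by the reduced frame. [folklore] -/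
theorem localModPow_eq_conj (v : HeightOneSpectrum (𝓞 F)) (n : ℕ)
    (σ : absoluteGaloisGroup (v.adicCompletion F)) :
    𝓡.localModPow v n σ =
      (𝓡.noFrameModPow v n)⁻¹ *
        Matrix.GeneralLinearGroup.map (Ideal.Quotient.mk (maximalIdeal 𝓡.R ^ n))
          (𝓡.ρ (absGaloisRestrict F (v.adicCompletion F) σ)) * 𝓡.noFrameModPow v n := by
  rw [localModPow_apply, localRep_apply, map_mul, map_mul, map_inv]
  rfl

/-- **`localModPow v n` has open kernel** (continuity of `Γ_{F_v} → Γ_F` and of `ρ_𝒟 mod 𝔪ⁿ`).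
[cite: Mazur1997Deformation, §2] -/
theorem isOpen_ker_localModPow (v : HeightOneSpectrum (𝓞 F)) (n : ℕ) :
    IsOpen (((𝓡.localModPow v n).ker : Subgroup (absoluteGaloisGroup (v.adicCompletion F))) :
      Set (absoluteGaloisGroup (v.adicCompletion F))) := by
  have hker : (((𝓡.localModPow v n).ker : Subgroup (absoluteGaloisGroup (v.adicCompletion F))) :
      Set (absoluteGaloisGroup (v.adicCompletion F))) =
      absGaloisRestrict F (v.adicCompletion F) ⁻¹'
        ((((Matrix.GeneralLinearGroup.map (Ideal.Quotient.mk (maximalIdeal 𝓡.R ^ n))).comp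
          𝓡.ρ).ker : Subgroup (absoluteGaloisGroup F)) : Set (absoluteGaloisGroup F)) := by
    ext σ
    simp only [SetLike.mem_coe, MonoidHom.mem_ker, Set.mem_preimage, MonoidHom.comp_apply,
      localModPow_eq_conj]
    constructor
    · intro h
      have h' := congrArg (fun g => 𝓡.noFrameModPow v n * g * (𝓡.noFrameModPow v n)⁻¹) h
      simpa [mul_assoc] using h'
    · intro h
      rw [h, mul_one, inv_mul_cancel]
  rw [hker]
  exact (𝓡.isLift.isAdicContinuous n).preimage (absGaloisRestrict F (v.adicCompletion F)).continuous

/-- **`localModPow v n` is upper triangular for `v ∣ p`** (values in the Borel subgroup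
`parabolicGL id`). [cite: Bockle2007Presentations, Theorem 7.6] -/
theorem localModPow_mem_borel (v : HeightOneSpectrum (𝓞 F)) (hv : (p : 𝓞 F) ∈ v.asIdeal) (n : ℕ)
    (σ : absoluteGaloisGroup (v.adicCompletion F)) :
    𝓡.localModPow v n σ ∈
      LiftingObstruction.parabolicGL (id : Fin 2 → Fin 2) (𝓡.R ⧸ maximalIdeal 𝓡.R ^ n) := by
  rw [LiftingObstruction.mem_parabolicGL_id_fin_two_iff, localModPow_apply]
  change Ideal.Quotient.mk (maximalIdeal 𝓡.R ^ n) ((𝓡.localRep v σ).val 1 0) = 0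
  rw [𝓡.localRep_lowerLeft v hv σ, map_zero]

/-! ## 2. The local Borel obstruction class -/

section SmallExtension

variable {n : ℕ} {B : Type} [CommRing B] [TopologicalSpace B] [DiscreteTopology B]
  {q : B →+* 𝓡.R ⧸ maximalIdeal 𝓡.R ^ n} (hq : Function.Surjective q)
  (hI : ∀ x ∈ RingHom.ker q, ∀ y ∈ RingHom.ker q, x * y = 0)
  (v : HeightOneSpectrum (𝓞 F)) (hv : (p : 𝓞 F) ∈ v.asIdeal)

/-- **The local obstruction class at `v ∣ p`** of `ρ_𝒟 mod 𝔪ⁿ` with respect to the small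
extension `q : B ↠ R_𝒟/𝔪ⁿ`: Mazur's Borel obstruction class
`o_v(ρ_n) ∈ H²_cont(Γ_{F_v}, 𝔟 ⊗ I)` of the upper-triangular representation `localModPow v n`
(for the standard Borel-compatible section `stdSection`).
[cite: Mazur1989Deforming, §1.6 Prop. 2] [cite: Bockle2007Presentations, Theorem 7.6] -/
def localObstruction :
    continuousCohomology 2 (LiftingObstruction.adKerParabolicRep (id : Fin 2 → Fin 2) hI
      (LiftingObstruction.map_stdSection hq hI)
      (fun _ hg => LiftingObstruction.stdSection_mem_parabolicGL id hq hI hg)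
      (𝓡.localModPow v n) (𝓡.localModPow_mem_borel v hv n)
      (𝓡.isOpen_ker_localModPow v n)).toTopRep :=
  LiftingObstruction.parabolicObstructionClass (id : Fin 2 → Fin 2) hI
    (LiftingObstruction.map_stdSection hq hI)
    (fun _ hg => LiftingObstruction.stdSection_mem_parabolicGL id hq hI hg)
    (𝓡.localModPow v n) (𝓡.localModPow_mem_borel v hv n) (𝓡.isOpen_ker_localModPow v n)

/-- **Vanishing of the local obstruction gives an upper-triangular lift**: if `o_v(ρ_n) = 0` then
`ρ_n|_{Γ_{F_v}}` (in the frame `noFrame v`) lifts to a homomorphism `Γ_{F_v} → GL₂(B)` with open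
kernel and upper-triangular values — a nearly ordinary lift at `v` with the same special line.
[cite: Mazur1989Deforming, §1.6 Prop. 2] [cite: Bockle2007Presentations, Theorem 7.6] -/
theorem exists_borelLift_of_localObstruction_eq_zero (h : 𝓡.localObstruction hq hI v hv = 0) :
    ∃ ρv : absoluteGaloisGroup (v.adicCompletion F) →* GL (Fin 2) B,
      (∀ σ, Matrix.GeneralLinearGroup.map q (ρv σ) = 𝓡.localModPow v n σ) ∧
      IsOpen ((ρv.ker : Subgroup (absoluteGaloisGroup (v.adicCompletion F))) :
        Set (absoluteGaloisGroup (v.adicCompletion F))) ∧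
      ∀ σ, (ρv σ : Matrix (Fin 2) (Fin 2) B) 1 0 = 0 := by
  obtain ⟨ρ', hopen, hP, hρ'⟩ :=
    (LiftingObstruction.parabolicObstructionClass_eq_zero_iff (id : Fin 2 → Fin 2) hI
      (LiftingObstruction.map_stdSection hq hI)
      (fun _ hg => LiftingObstruction.stdSection_mem_parabolicGL id hq hI hg)
      (𝓡.localModPow v n) (𝓡.localModPow_mem_borel v hv n) (𝓡.isOpen_ker_localModPow v n)).mp h
  exact ⟨ρ', hρ', hopen, fun σ =>
    (LiftingObstruction.mem_parabolicGL_id_fin_two_iff _).mp (hP σ)⟩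

/-- Conversely, **an upper-triangular lift of `ρ_n|_{Γ_{F_v}}` with open kernel kills the local
obstruction.** [cite: Mazur1989Deforming, §1.6 Prop. 2] -/
theorem localObstruction_eq_zero_of_borelLift
    (ρv : absoluteGaloisGroup (v.adicCompletion F) →* GL (Fin 2) B)
    (hq' : ∀ σ, Matrix.GeneralLinearGroup.map q (ρv σ) = 𝓡.localModPow v n σ)
    (hopen : IsOpen ((ρv.ker : Subgroup (absoluteGaloisGroup (v.adicCompletion F))) :
      Set (absoluteGaloisGroup (v.adicCompletion F))))
    (hup : ∀ σ, (ρv σ : Matrix (Fin 2) (Fin 2) B) 1 0 = 0) :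
    𝓡.localObstruction hq hI v hv = 0 :=
  (LiftingObstruction.parabolicObstructionClass_eq_zero_iff (id : Fin 2 → Fin 2) hI
      (LiftingObstruction.map_stdSection hq hI)
      (fun _ hg => LiftingObstruction.stdSection_mem_parabolicGL id hq hI hg)
      (𝓡.localModPow v n) (𝓡.localModPow_mem_borel v hv n) (𝓡.isOpen_ker_localModPow v n)).mpr
    ⟨ρv, hopen, fun σ => (LiftingObstruction.mem_parabolicGL_id_fin_two_iff _).mpr (hup σ), hq'⟩

end SmallExtension

end NearlyOrdinaryDeformationRing

end Literature.NumberTheory.GaloisRepresentations
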